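import Literature.Barriers.ValiantsHypothesis.GCTMatrixPoweringProofs
import HarnessLib

/-!
# GCT and matrix powering (Gesmundo–Ikenmeyer–Panova 2017): Prop. 13 in its printed numeric
# form, unconditional shape constraints on orbit occurrence obstructions, and the no-go readings
# from Prop. 20 alone

Second proofs file (D-0014) of `GCTMatrixPowering.lean`, downstream of
`GCTMatrixPoweringProofs.lean` (conventions as there: tree letters PERMANENT size `n`, MATRIX size
`m`, `λ ⊢ d·n`, "`λ` occurs in `ℂ[\overline{GL_{m²} per_n}]`" =
`HasHighestWeight (blockPerOrbitRep n m) (partitionWeightLex m λ)`, "`λ` occurs in `ℂ[Sym^n V^*]`"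
= `HasHighestWeight (coordRep (MatIdx m) ℂ n) (partitionWeightLex m λ)`, `V = ℂ^{m²}`). Theorems
only, all short consequences of the PROVED Lemma 12 (`GIP2017_lemma12`) and Prop. 13
(`GIP2017_prop13`) of that file:

* `highestWeightSpace_coordRep_partitionWeightLex_eq_bot`,
  `plethysmCoeff_partitionWeightLex_eq_zero_of_sup_lt` — GIP Prop. 13 AS PRINTED, "If `λ₁ < m`,
  then `a_λ(d[m]) = 0`": for `d ≥ 1` and `λ ⊢ d·n` with `λ₁ < n` (at most `m²` parts) the
  highest-weight space of weight `λ^*` of `ℂ[Sym^n V^*]` is zero, so the tree's plethysm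
  coefficient `plethysmCoeff ℂ (MatIdx m) n λ^* = a_λ(d[n])` vanishes (the companion file states
  Prop. 13 in the contrapositive occurrence form `λ occurs ⇒ λ₁ ≥ n`).
* `le_sup_parts_of_hasHighestWeight_blockPerOrbitRep`, `IsOrbitOccurrenceObstruction.le_sup_parts`
  — UNCONDITIONALLY, every `λ ⊢ d·n` (`d ≥ 1`, `0 < n ≤ m`) occurring in `ℂ[\overline{GL · per_n}]`,
  in particular every orbit occurrence obstruction of the technique class
  `IsOrbitOccurrenceObstruction`, has `λ₁ ≥ n` and `ℓ(λ) ≤ n²` ("By Lemma 12 this implies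
  `|λ| = dm`, `ℓ(λ) ≤ m²`, and `a_λ(d[m]) > 0`. The following Prop. 13 ensures that `λ₁ ≥ m`",
  GIP p. 7); what remains conditional (on `GIP2017_prop20` / `GIP2017_prop14`, the symmetric
  Kronecker positivity with its computer-verified base cases, Prop. 18) is only that such shapes
  have `sm(λ, m) > 0`.
* `not_isOrbitOccurrenceObstruction_of_prop20`, `not_certifies_superlinear_of_prop20` — the two
  no-go readings of the barrier file (`GCTMatrixPowering.not_isOrbitOccurrenceObstruction`,
  `.not_certifies_superlinear`) with the barrier fact replaced by its remaining trust base
  `GIP2017_prop20` (`gctMatrixPowering_of_prop20`).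

## References

* [GesmundoIkenmeyerPanova2017] F. Gesmundo, C. Ikenmeyer, G. Panova, *Geometric complexity
  theory and matrix powering*, Diff. Geom. Appl. 55 (2017) 106–127 = arXiv:1611.00827 (held):
  abstract, §2.2 Cor. 9, Thm. 10 and its proof (p. 7), Lemma 12, Prop. 13 (§7), Prop. 14,
  Prop. 20, Prop. 18.
-/

noncomputable section

namespace Literature.Barriers.ValiantsHypothesis

open Literature.NumberTheory.DiophantineGeometry Literature.Computability.AlgebraicComplexity
  Literature.Computability.Complexity

/-! ### Prop. 13 as printed: `a_λ(d[n]) = 0` -/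

/-- **GIP Prop. 13 in subspace form**: for `d ≥ 1` and `λ ⊢ d·n` with at most `m²` parts and
`λ₁ < n`, the highest-weight space of weight `λ^*` of `ℂ[Sym^n V^*]`, `V = ℂ^{m²}`, is zero (no
highest-weight vector in any degree: a weight pins the degree). [cite: GesmundoIkenmeyerPanova2017, Prop. 13] -/
theorem highestWeightSpace_coordRep_partitionWeightLex_eq_bot {n m d : ℕ} (hd : 0 < d)
    (lam : Nat.Partition (d * n)) (hlam : lam.parts.card ≤ m * m) (hsup : lam.parts.sup < n) :
    highestWeightSpace (coordRep (MatIdx m) ℂ n) (partitionWeightLex m lam) = ⊥ := by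
  by_contra hne
  exact absurd (GIP2017_prop13 lam hlam hd hne) (not_le.mpr hsup)

/-- **GIP Prop. 13 as printed, numerically: "If `λ₁ < m`, then `a_λ(d[m]) = 0`."** The plethysm
coefficient `a_λ(d[n]) = plethysmCoeff ℂ (MatIdx m) n λ^*` (the tree's multiplicity of the weight
`λ^*` in `ℂ[Sym^n V^*]`, `V = ℂ^{m²}`; tree letters, inner degree `n` = GIP's `m`) vanishes for
`d ≥ 1`, `λ ⊢ d·n` with `λ₁ < n` and at most `m²` parts (for `d = 0` the printed sentence fails:
`a_∅(0[m]) = 1`). [cite: GesmundoIkenmeyerPanova2017, Prop. 13] -/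
theorem plethysmCoeff_partitionWeightLex_eq_zero_of_sup_lt {n m d : ℕ} (hd : 0 < d)
    (lam : Nat.Partition (d * n)) (hlam : lam.parts.card ≤ m * m) (hsup : lam.parts.sup < n) :
    plethysmCoeff ℂ (MatIdx m) n (partitionWeightLex m lam) = 0 := by
  rw [plethysmCoeff, hwMultiplicity,
    highestWeightSpace_coordRep_partitionWeightLex_eq_bot hd lam hlam hsup, finrank_bot]

/-! ### Unconditional shape constraints on orbit occurrence obstructions -/

/-- **Shape of occurring partitions (Lemma 12 + Prop. 13, unconditional).** For `0 < n ≤ m` and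
`d ≥ 1`, every `λ ⊢ d·n` (at most `m²` parts) occurring in `ℂ[\overline{GL_{m²} per_n}]` has
`λ₁ ≥ n` and `ℓ(λ) ≤ n²` ("By Lemma 12 this implies … `ℓ(λ) ≤ m²` … Prop. 13 ensures that
`λ₁ ≥ m`", GIP letters). [cite: GesmundoIkenmeyerPanova2017, Thm. 10 (proof, p. 7), Lemma 12, Prop. 13] -/
theorem le_sup_parts_of_hasHighestWeight_blockPerOrbitRep {n m d : ℕ} (hn : 0 < n) (hnm : n ≤ m)
    (hd : 0 < d) (lam : Nat.Partition (d * n)) (hlam : lam.parts.card ≤ m * m)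
    (h : HasHighestWeight (blockPerOrbitRep n m) (partitionWeightLex m lam)) :
    n ≤ lam.parts.sup ∧ lam.parts.card ≤ n ^ 2 := by
  obtain ⟨hcoord, hlen⟩ := GIP2017_lemma12 hn hnm lam hlam h
  exact ⟨GIP2017_prop13 lam hlam hd hcoord, hlen⟩

/-- Consequently an orbit occurrence obstruction `λ ⊢ d·n` (`IsOrbitOccurrenceObstruction`,
`0 < n ≤ m`, `d ≥ 1`) has `λ₁ ≥ n` and `ℓ(λ) ≤ n²` — unconditionally; it is Prop. 14 / Prop. 20
that excludes these shapes for `n ≥ 10`, `m ≥ n + 2`. [cite: GesmundoIkenmeyerPanova2017, Cor. 9 and Thm. 10 (proof)] -/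
theorem IsOrbitOccurrenceObstruction.le_sup_parts {n m d : ℕ} (hn : 0 < n) (hnm : n ≤ m)
    (hd : 0 < d) {lam : Nat.Partition (d * n)} (hobs : IsOrbitOccurrenceObstruction n m lam) :
    n ≤ lam.parts.sup ∧ lam.parts.card ≤ n ^ 2 :=
  le_sup_parts_of_hasHighestWeight_blockPerOrbitRep hn hnm hd lam hobs.1 hobs.2.1

/-! ### The no-go readings from Prop. 20 alone -/

/-- **The no-go theorem from Prop. 20 alone**: no orbit occurrence obstruction exists for
`n ≥ 10`, `m ≥ n + 2` (`GCTMatrixPowering.not_isOrbitOccurrenceObstruction` fed with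
`gctMatrixPowering_of_prop20`). [cite: GesmundoIkenmeyerPanova2017, Thm. 10] -/
theorem not_isOrbitOccurrenceObstruction_of_prop20 (h20 : GIP2017_prop20) {n m d : ℕ}
    (hn : 10 ≤ n) (hm : n + 2 ≤ m) (lam : Nat.Partition (d * n)) :
    ¬ IsOrbitOccurrenceObstruction n m lam :=
  (gctMatrixPowering_of_prop20 h20).not_isOrbitOccurrenceObstruction hn hm lam

/-- **"No superlinear lower bounds" from Prop. 20 alone**: for `n ≥ 10`, an orbit occurrence
obstruction at matrix size `m` forces `m ≤ n + 1` ("there are no orbit occurrence obstructions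
that prove even superlinear lower bounds on the complexity of the permanent").
[cite: GesmundoIkenmeyerPanova2017, abstract and Thm. 10] -/
theorem not_certifies_superlinear_of_prop20 (h20 : GIP2017_prop20) {n m d : ℕ} (hn : 10 ≤ n)
    (lam : Nat.Partition (d * n)) (hobs : IsOrbitOccurrenceObstruction n m lam) : m ≤ n + 1 :=
  (gctMatrixPowering_of_prop20 h20).not_certifies_superlinear hn lam hobs

end Literature.Barriers.ValiantsHypothesis

end
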